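/-
Copyright: cell `pub-ymgap` (HUMAN RULING D-0062), Track A of `YM-PLAN.md`, DAG node N20 (= NE7b); R134 acceleration seat
`pub-ymgap-dag-n20-c` (strategy s1, generation 22), module 63.  Released under the licence of the surrounding project.
-/
import Summits.QuantumFields.YangMills.Theorems.BalabanUVNodesN20LCSMinimiserEnergyComparison
import HarnessLib

/-!
# YM-DAG node N20 (= NE7b), row s1, module 63: THE ROW's TWO NAMED PROPS AT ARBITRARY PINNED LEVELS MODULO (W) ALONE — module 48 §5
# (`PointwiseExtraction ∧ LocCondStability` modulo (W) + (T)) with (T) STRUCK by module 59, at the canonical regions of a `39^d` skeleton, explicit rates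

Track A of `YM-PLAN.md` (cell `pub-ymgap`, HUMAN RULING D-0062), node **N20** = spine estimate NE7b (`T4WeightBudget.RelWeightBound`, NOT
PRINTED, NOT PROVED).  Seat `pub-ymgap-dag-n20-c` (R134, s1), generation 22, module 63.  Kernel theorems only: 0 `def`, 0 `sorry`, standard
axioms; COUNT-NEUTRAL.  Composition BY NAME of module 48 §5 (`…N20LCSInstanceModuloTwo.halves_rec_pinnedLevels_hullWindow_of_regularity`), module 59
(`…N20LCSMinimiserEnergyComparison.hThm1_of_crude`) and module 51 (`…N20LCSCanonicalSkeleton`: `exists_canon_skeleton`, `card_canon_le`).  Nothing re-declared.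

WHAT THIS FILE PROVES.  ★★★ `halves_rec_pinnedLevels_hullWindow_crude`: for every finite set `J` of pinned levels (geometric letters `j + 1 ≤ m + K`,
`L^{j+1}M₁ ∣ 2L^{m+K}`, `LM₁ ≤ sideχ_j`, `0 < ε_{j+1}`) and EVERY family of pinned cubes `D j`, on a `39^d`-dense skeleton `D′ j ⊆ D j` (pairwise disjoint canonical
regions `R♮_j`), BOTH named Props of the row — `PointwiseExtraction ∧ LocCondStability` on Bałaban's label tower at the residual of record — hold with module 41's
windowed indicator carriers at thresholds `ε⋆_j = ε_{j+1}∕B_j`, `B_j = √(N·n⋆_j)·L^{2(j+1)}`, and explicit per-level rates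
`rate j = (m_j·exp(C_j·A_j·M_h²·δ_j − δ_j·β_j·ε⋆_j²∕(2N)))^{#D′ j}`, `m_j = d²(9LM₂R_{j+1})^d` — MODULO (W) ALONE («LCS-j on the hull of the skeleton's canonical
regions inside the (3.2) window», module 48's `hLSw` verbatim at `R♮`).  The regularity letter (T) of module 48 §5 is module 59's theorem.

HONEST SCOPE.  As modules 59–62: `B_j ~ L^{4j}` is LEVEL-DEPENDENT, so `rate j < 1` is a fixed-depth small-coupling condition (module 61's `γ(θ)` at level 0);
the level-uniform constant is [Balaban1985Variational] Thm 1 (8) (K0's pen); (W) at `j ≥ 1` is THE wall.  NE7b NOT PRINTED ∕ NOT PROVED; (α)-instance 0∕1;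
N20 NOT discharged; typed 28∕28, count untouched; one finite four-torus at fixed `ε` — NOT ℝ⁴, NOT infinite volume, NOT OS, NOT a mass gap, NOT Clay.

References (LOCATORS): T. Bałaban, CMP 119 (1988) 243–285 [Balaban1988Convergent] ((3.2) p.265, (3.26)–(3.30) pp.270–271, (2.16)–(2.17) p.257); CMP 122
(1989) 175–202 [Balaban1989LargeFieldI] ((0.3)–(0.5) pp.176–177); CMP 102 (1985) 277–309 [Balaban1985Variational] (Thm 1 (8)–(9) p.279).
-/

set_option autoImplicit false

noncomputable section

open scoped BigOperators

namespace Summit.QuantumFields.YangMills.BalabanUVNodes.N20LCSNamedPropsCrude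

open MeasureTheory
open Literature.MathematicalPhysics.QuantumFieldTheory.Balaban1983to89
open Literature.MathematicalPhysics.QuantumFieldTheory.Balaban1983to89.T4Continuum
open Literature.MathematicalPhysics.QuantumFieldTheory.Balaban1983to89.B14.Eq218Concrete
open Literature.MathematicalPhysics.QuantumFieldTheory.Balaban1983to89.Node00
open B15DeterminingSets B14.Eq213DetSet B14.Eq216Concrete B14.Eq213MaximalDomains B15Eq112TorusCover B14DomainGeom
open Literature.MathematicalPhysics.QuantumFieldTheory.BalabanImbrieJaffe1984to88.BIJ85Eq453GaugeField (qsstarGIter0)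
open ExpMeanLog (deltaSU)
open Summit.QuantumFields.BalabanUV.T4Continuum.B16HistoryIndexedRepr (GoodClass)
open Summit.QuantumFields.BalabanUV.T4Continuum.B16HistoryReprChain
open Summit.QuantumFields.BalabanUV.T4Continuum.NE7b.PrefixExtraction (admS)
open Summit.QuantumFields.BalabanUV.T4Continuum.NE7b.LocalConditionalStability (LocCondStability PointwiseExtraction)
open Summit.QuantumFields.YangMills.BalabanUVNodes.N20LCSLabelTower
open Summit.QuantumFields.YangMills.BalabanUVNodes.N20LCSAvgDominationRegion (boxRegion)
open Summit.QuantumFields.YangMills.BalabanUVNodes.N20LCSInstanceModuloTwo (halves_rec_pinnedLevels_hullWindow_of_regularity)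
open Summit.QuantumFields.YangMills.BalabanUVNodes.N20LCSCanonicalSkeleton (exists_canon_skeleton card_canon_le)
open Summit.QuantumFields.YangMills.BalabanUVNodes.N20LCSMinimiserEnergyComparison (hThm1_of_crude)

variable (F : T4Family) (N : ℕ) [NeZero N] (ν : Stage7Numerics) (M : ℕ) (p : B12.RunParams) (g : ℕ → ℝ) (A₁ : ℝ)

open Classical in
/-- ★★★ **`PointwiseExtraction ∧ LocCondStability` ON BAŁABAN's LABEL TOWER AT THE RESIDUAL OF RECORD, ARBITRARY PINNED FAMILIES, MODULO (W) ALONE**: module 48 §5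
at the canonical regions `R♮_j(c)` of a `39^d`-dense skeleton `D′ ⊆ D` (module 51), thresholds `ε⋆_j = ε_{j+1}∕(√(N·n⋆_j)·L^{2(j+1)})`, sizes `m_j = d²(9LM₂R_{j+1})^d`, with the
regularity letter `hThm1` SUPPLIED by module 59 (`hThm1_of_crude`); the moment hypothesis is (W) on the hull of the skeleton's canonical regions inside the window,
verbatim.  Per-level rates explicit; LEVEL-DEPENDENT (gainful at fixed depth only). [cite: Balaban1988Convergent, (3.2) p.265, (3.26)–(3.30) pp.270–271; Balaban1989LargeFieldI, (0.3)–(0.5) pp.176–177; Balaban1985Variational, Thm 1 (9) p.279] -/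
theorem halves_rec_pinnedLevels_hullWindow_crude {ρ₀ : cfgOfRecord F N p.K 0 → ℝ}
    (hρ : (bddMeas (cfgOfRecord F N p.K 0)).Gd ρ₀) (h0 : ∀ U, 0 ≤ ρ₀ U) (hM₂ : 0 < ν.M₂) (hM₁ : 1 ≤ ν.M₁)
    (J : Finset ℕ) (hJ : ∀ j ∈ J, j < p.K) (hJm : ∀ j ∈ J, j + 1 ≤ (F.P p.K).m + (F.P p.K).K)
    (hdiv : ∀ j ∈ J, side (F.P p.K).L ν.M₁ (j + 1) ∣ (F.P p.K).sitesPerDir 0) (hsz : ∀ j ∈ J, side (F.P p.K).L ν.M₁ 1 ≤ sideχ F ν p g j)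
    (hεk : ∀ j ∈ J, 0 < epsOfRecord ν g (j + 1)) (D : (j : ℕ) → Finset (Iχ F ν p g j))
    (α β C a₀ δ : ℕ → ℝ) (hα : ∀ j ∈ J, 0 < α j)
    (hguard : ∀ j ∈ J, (((((F.P p.K).d + 2) * (F.P p.K).L : ℕ) : ℝ) ^ 2 / 4) * Real.sqrt (2 * (Fintype.card (Fin N) : ℝ) * α j) <
      deltaSU (Fin N))
    (hβ : ∀ j ∈ J, 0 ≤ β j) (hC : ∀ j ∈ J, 0 ≤ C j) (hδ0 : ∀ j ∈ J, 0 ≤ δ j)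
    (hδ : ∀ j ∈ J, δ j * ((2 * (Fintype.card (Fin N) : ℝ) * (((F.P p.K).L : ℝ) ^ 2 + 6 * ((((F.P p.K).d + 2) * (F.P p.K).L : ℕ) : ℝ) ^ 2) ^ 2 +
        2 / α j) * (((2 * (((F.P p.K).d + 3) * (F.P p.K).L + 2) + 1) ^ (F.P p.K).d * (F.P p.K).d ^ 2 : ℕ) : ℝ)) ≤ a₀ j) :
    ∃ D' : (j : ℕ) → Finset (Iχ F ν p g j), (∀ j, D' j ⊆ D j ∧ (D j).card ≤ 39 ^ (F.P p.K).d * (D' j).card) ∧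
    ∀ (K' : ℕ) (E : (j : ℕ) → (Fin j → LabelPat F ν p g) → Finset (LbOfRecord F ν p g j)), (∀ j ∈ J, ∀ h t, t ∈ E j h → D j ⊆ t.1) →
    (∀ j ∈ J, j < K' → ∀ h : Fin j → LabelPat F ν p g,
      h ∈ admS (labelTowerOfRecord F N ν M p g A₁ (zeta316OfRecord F N ν M A₁)) (labelPattern F ν p g E) j →
      D' j ⊆ cubes32 F ν M p g j (seqOfHist F ν M p g j h) →
      ∀ a : ℝ, 0 ≤ a → a ≤ a₀ j → ∀ X : Finset (Plaq (F.P p.K) j),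
        (∀ q ∈ X, ∃ c ∈ D' j, ∃ p' ∈ (Finset.univ.filter fun q : Plaq (F.P p.K) (j + 1) => embIter (j + 1) q.src ∈ cubeEnl (F.P p.K) (sideχ F ν p g j) c 4),
          q ∈ boxRegion (emb p'.src) (((F.P p.K).d + 3) * (F.P p.K).L + 2)) →
        ∫ U, Real.exp (a * β j * ∑ q ∈ X, (1 - reTr (GaugeField.plaqHol U q))) *
            (labelTowerOfRecord F N ν M p g A₁ (zeta316OfRecord F N ν M A₁)).eterm ρ₀ j h U ∂(lawOfRecord F N p.K j) ≤
          Real.exp (C j * a * X.card) * ∫ U, (labelTowerOfRecord F N ν M p g A₁ (zeta316OfRecord F N ν M A₁)).eterm ρ₀ j h U ∂(lawOfRecord F N p.K j)) →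
    PointwiseExtraction (labelTowerOfRecord F N ν M p g A₁ (zeta316OfRecord F N ν M A₁)) (labelPattern F ν p g E) K'
        (labelChi F N ν M p g A₁ (zeta316OfRecord F N ν M A₁))
        (fun j h U => if j ∈ J then (if D' j ⊆ cubes32 F ν M p g j (seqOfHist F ν M p g j h) then
          Set.indicator {U : cfgOfRecord F N p.K j |
            ∀ c ∈ D' j, ∃ p' ∈ (Finset.univ.filter fun q : Plaq (F.P p.K) (j + 1) => embIter (j + 1) q.src ∈ cubeEnl (F.P p.K) (sideχ F ν p g j) c 4),
              epsOfRecord ν g (j + 1) /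
                  (Real.sqrt ((N : ℝ) * (((F.P p.K).d ^ 2 * (9 * sideχ F ν p g j) ^ (F.P p.K).d : ℕ) : ℝ)) * ((F.P p.K).L : ℝ) ^ (2 * (j + 1))) ≤
                dist1 (GaugeField.plaqHol ((avOfRecord F N p.K j).avg U) p')} (fun _ => (1 : ℝ)) U else 0) else 1)
        (fun _ _ => 0) ∧
      LocCondStability (labelTowerOfRecord F N ν M p g A₁ (zeta316OfRecord F N ν M A₁)) (labelPattern F ν p g E) K' (lawOfRecord F N p.K) ρ₀
        (fun j h U => if j ∈ J then (if D' j ⊆ cubes32 F ν M p g j (seqOfHist F ν M p g j h) then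
          Set.indicator {U : cfgOfRecord F N p.K j |
            ∀ c ∈ D' j, ∃ p' ∈ (Finset.univ.filter fun q : Plaq (F.P p.K) (j + 1) => embIter (j + 1) q.src ∈ cubeEnl (F.P p.K) (sideχ F ν p g j) c 4),
              epsOfRecord ν g (j + 1) /
                  (Real.sqrt ((N : ℝ) * (((F.P p.K).d ^ 2 * (9 * sideχ F ν p g j) ^ (F.P p.K).d : ℕ) : ℝ)) * ((F.P p.K).L : ℝ) ^ (2 * (j + 1))) ≤
                dist1 (GaugeField.plaqHol ((avOfRecord F N p.K j).avg U) p')} (fun _ => (1 : ℝ)) U else 0) else 1)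
        (fun j _ => if j ∈ J then Real.log (((((F.P p.K).d ^ 2 * (9 * ((F.P p.K).L * ν.M₂ * RkOfRecord (F.P p.K).L ν.r (g (j + 1)))) ^ (F.P p.K).d : ℕ) : ℝ) *
          Real.exp (C j * ((2 * (Fintype.card (Fin N) : ℝ) *
            (((F.P p.K).L : ℝ) ^ 2 + 6 * ((((F.P p.K).d + 2) * (F.P p.K).L : ℕ) : ℝ) ^ 2) ^ 2 + 2 / α j) *
          (((2 * (((F.P p.K).d + 3) * (F.P p.K).L + 2) + 1) ^ (F.P p.K).d * (F.P p.K).d ^ 2 : ℕ) : ℝ)) *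
          (((2 * (((F.P p.K).d + 3) * (F.P p.K).L + 2) + 1) ^ (F.P p.K).d * (F.P p.K).d ^ 2 : ℕ) : ℝ) * δ j -
            δ j * β j * ((epsOfRecord ν g (j + 1) /
                  (Real.sqrt ((N : ℝ) * (((F.P p.K).d ^ 2 * (9 * sideχ F ν p g j) ^ (F.P p.K).d : ℕ) : ℝ)) * ((F.P p.K).L : ℝ) ^ (2 * (j + 1)))) ^ 2 /
              (2 * (Fintype.card (Fin N) : ℝ))))) ^ (D' j).card) else 0) := by
  choose D' hsub hdisj hcard using fun j => exists_canon_skeleton F ν p g j hM₂ (D j)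
  refine ⟨D', fun j => ⟨hsub j, hcard j⟩, ?_⟩
  intro K' E hE hLSw
  have hL0 : (0 : ℝ) < (F.P p.K).L := by exact_mod_cast (F.P p.K).L_pos
  have hN0 : (0 : ℝ) < N := by exact_mod_cast Nat.pos_of_ne_zero (NeZero.ne N)
  have hη : ∀ j, 0 < (F.P p.K).eta (j + 1) ^ 2 := fun j => by
    have : 0 < (F.P p.K).eta (j + 1) := by
      unfold Params.eta
      exact pow_pos (inv_pos.2 hL0) _
    positivity
  have hn1 : ∀ j, (1 : ℝ) ≤ (((F.P p.K).d ^ 2 * (9 * sideχ F ν p g j) ^ (F.P p.K).d : ℕ) : ℝ) := fun j => by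
    have hs : 1 ≤ sideχ F ν p g j := by
      unfold sideχ cubeSide
      exact Nat.one_le_iff_ne_zero.2 (Nat.mul_ne_zero (Nat.mul_ne_zero (pow_ne_zero _ (F.P p.K).L_pos.ne') (by omega))
        (by have := B14SeparationOfRecord.one_le_RkOfRecord (F.P p.K).L_pos ν.r (g (j + 1)); omega))
    exact_mod_cast Nat.one_le_iff_ne_zero.2 (Nat.mul_ne_zero (pow_ne_zero _ (by have := (F.P p.K).hd; omega)) (pow_ne_zero _ (by omega)))
  have hB0 : ∀ j, 0 < Real.sqrt ((N : ℝ) * (((F.P p.K).d ^ 2 * (9 * sideχ F ν p g j) ^ (F.P p.K).d : ℕ) : ℝ)) *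
      ((F.P p.K).L : ℝ) ^ (2 * (j + 1)) := fun j => by
    have := hn1 j
    have : 0 < Real.sqrt ((N : ℝ) * (((F.P p.K).d ^ 2 * (9 * sideχ F ν p g j) ^ (F.P p.K).d : ℕ) : ℝ)) := Real.sqrt_pos.2 (by positivity)
    positivity
  have hBη : ∀ j, Real.sqrt ((N : ℝ) * (((F.P p.K).d ^ 2 * (9 * sideχ F ν p g j) ^ (F.P p.K).d : ℕ) : ℝ)) ≤
      Real.sqrt ((N : ℝ) * (((F.P p.K).d ^ 2 * (9 * sideχ F ν p g j) ^ (F.P p.K).d : ℕ) : ℝ)) * ((F.P p.K).L : ℝ) ^ (2 * (j + 1)) *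
        (F.P p.K).eta (j + 1) ^ 2 := fun j => by
    unfold Params.eta
    rw [← pow_mul, inv_pow, mul_comm (j + 1) 2, mul_assoc, mul_inv_cancel₀ (by positivity), mul_one]
  have hm1 : ∀ j, 1 ≤ (F.P p.K).d ^ 2 * (9 * ((F.P p.K).L * ν.M₂ * RkOfRecord (F.P p.K).L ν.r (g (j + 1)))) ^ (F.P p.K).d := fun j => by
    have hR : 1 ≤ RkOfRecord (F.P p.K).L ν.r (g (j + 1)) := B14SeparationOfRecord.one_le_RkOfRecord (F.P p.K).L_pos _ _
    have h9 : 1 ≤ 9 * ((F.P p.K).L * ν.M₂ * RkOfRecord (F.P p.K).L ν.r (g (j + 1))) := by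
      have : 1 ≤ (F.P p.K).L * ν.M₂ * RkOfRecord (F.P p.K).L ν.r (g (j + 1)) :=
        Nat.one_le_iff_ne_zero.2 (Nat.mul_ne_zero (Nat.mul_ne_zero (F.P p.K).L_pos.ne' (by omega)) (by omega))
      omega
    exact Nat.one_le_iff_ne_zero.2 (Nat.mul_ne_zero (pow_ne_zero _ (by have := (F.P p.K).hd; omega))
      (Nat.pos_iff_ne_zero.1 (Nat.one_le_pow _ _ h9)))
  -- the regularity letter of module 48 §5, supplied by module 59 at the canonical regions of the skeleton
  have hThm1 : ∀ j ∈ J, ∀ c ∈ D' j, ∀ (V' : GaugeField (F.P p.K) (j + 1) (SU N)) (U₀ : GaugeField (F.P p.K) 0 (SU N)),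
      IsMinimizer (avOfRecord F N p.K) {U | PlaqSmall (ν.εreg * (F.P p.K).eta (j + 1) ^ 2) U}
          (Bj ν.M₁ (cubeEnl (F.P p.K) (sideχ F ν p g j) c 4) (j + 1)) (avgFamily (avOfRecord F N p.K) (qsstarGIter0 (j + 1) V')) U₀ →
      (∀ p' ∈ (Finset.univ.filter fun q : Plaq (F.P p.K) (j + 1) => embIter (j + 1) q.src ∈ cubeEnl (F.P p.K) (sideχ F ν p g j) c 4),
        dist1 (GaugeField.plaqHol V' p') < epsOfRecord ν g (j + 1) /
          (Real.sqrt ((N : ℝ) * (((F.P p.K).d ^ 2 * (9 * sideχ F ν p g j) ^ (F.P p.K).d : ℕ) : ℝ)) * ((F.P p.K).L : ℝ) ^ (2 * (j + 1)))) →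
      PlaqSmallOn (plaqInside (cubeEnl (F.P p.K) (sideχ F ν p g j) c 1)) (epsOfRecord ν g (j + 1) * (F.P p.K).eta (j + 1) ^ 2) U₀ :=
    fun j hj c _ V' U₀ hmin hV' =>
      hThm1_of_crude F N ν p g (hJm j hj) hM₁ (hdiv j hj) (hsz j hj) (hB0 j) (hεk j hj) (hBη j) c V' U₀ hmin
        (fun p' hp' => hV' p' (Finset.mem_filter.2 ⟨Finset.mem_univ _, hp'⟩))
  exact halves_rec_pinnedLevels_hullWindow_of_regularity F N ν M p g A₁ hρ h0 J hJ D'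
    (fun j c => Finset.univ.filter fun q : Plaq (F.P p.K) (j + 1) => embIter (j + 1) q.src ∈ cubeEnl (F.P p.K) (sideχ F ν p g j) c 4)
    (fun j => (F.P p.K).d ^ 2 * (9 * ((F.P p.K).L * ν.M₂ * RkOfRecord (F.P p.K).L ν.r (g (j + 1)))) ^ (F.P p.K).d)
    (fun j => epsOfRecord ν g (j + 1) /
      (Real.sqrt ((N : ℝ) * (((F.P p.K).d ^ 2 * (9 * sideχ F ν p g j) ^ (F.P p.K).d : ℕ) : ℝ)) * ((F.P p.K).L : ℝ) ^ (2 * (j + 1))))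
    (fun j hj => (div_pos (hεk j hj) (hB0 j)).le) (fun j hj c _ => card_canon_le F ν p g j (hJm j hj) c) (fun j _ => hdisj j)
    (fun j hj => mul_pos (hεk j hj) (hη j)) hThm1 α β C a₀ δ _ hα hguard hβ hC hδ0 hδ (fun j _ => rfl)
    (fun j _ => pow_pos (mul_pos (by exact_mod_cast hm1 j) (Real.exp_pos _)) _) K' E (fun j hj h t ht => (hsub j).trans (hE j hj h t ht)) hLSw

end Summit.QuantumFields.YangMills.BalabanUVNodes.N20LCSNamedPropsCrude

end
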